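/-
Copyright (c) 2026 the pub-hodgecm-mathlib formalisation cell (harness21).  Prover seat hodgecm-mathlib-K2E1-p12 (g3), Track B ∕ K2-LIT, h413 = `stmt-HodgeConjecture-24833`,
route of record `HCCMUnconditional`, ROADCARD «5Res ENDGAME BY FAMILIES» AMENDMENT #3 — REPAIR (i) of the FINDING `K2/K2E1-p12/g3/FINDING-C7-vacuity-at-Kad.K2E1-p12-g3.md`: F3d-β″, the
pure-tensor decomposition WITHOUT the (jointly unsatisfiable) openness hypothesis `hK'o` on the level `K′ ≤ G(𝔸)` — replaced by OPENNESS OF THE `(B(𝔸), K′)`-DOUBLE COSETS, which holds at the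
adelic level `Kad = K_∞·K′_f` — and with continuity of the sections by RAY SCALING (no Iwasawa coordinates, no continuity of the `K′`-type `ω`).  §0 certifies the vacuity.
-/
import Summits.HodgeConjecture.HodgeConjecture.Theorems.K2E1PseudoEisensteinChiSectionStabiliserKTypeU2   -- ★ F3d-β_τ p860842 (this seat): `chi_mul_kType_eq_of_eq`, `kType_inv`; brings ★ F3d-β (stabiliser algebra), ★ DEFS, ★ bridge, ★ ray
import HarnessLib

/-!
# h413 ∕ Track B «K2-LIT», AMENDMENT #3 REPAIR (i) — helper `K2E1ChiIsotypicPureTensorDecompositionOpenCosetsU2` (F3d-β″): a continuous right-`(K′, ω)`-equivariant norm-one-Borel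
# `χ`-isotypic band function on `U(J₂)(𝔸_F)` is a finite sum of pure tensors `f(H)·φ`, `φ ∈ chiSectionSpace χ K′ ω` CONTINUOUS, under the SATISFIABLE hypothesis that the
# `(B(𝔸), K′)`-double cosets are OPEN (true for `K′ = K_∞·K′_f`) — instead of ★ F3d-β's `IsOpen K′`, which together with `hHK′` is contradictory (§0)

Cell `pub/hodgecm-mathlib`, crux h413 = `stmt-HodgeConjecture-24833`, route of record `HCCMUnconditional`; dealer K2E1-plan (g7); FINDING of this seat 2026-09-04T14:3xZ (bus `K2/STATUS.md`).
THEOREMS ONLY (no `def`, no `instance`, no notation, no named-fact hypothesis, no `sorry`); lane `--supports stmt-HodgeConjecture-24833 --as helper` (count-neutral).  Closes no socket.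
Generic quadratic datum `(F, E, c)`, `c² = 1`, `U(J₂)`; `K′ ≤ G(𝔸)` ANY subgroup with `H` right-`K′`-invariant (`hHK′`), finitely many `(B(𝔸),K′)`-double cosets (`hBK`) ALL OPEN (`hdo`);
`χ` ray-trivial; the `K′`-type `ω : ↥K′ → ℂ` multiplicative (`hωmul`) and unitary (`hω1`) — NOT assumed continuous.

§0 THE VACUITY CERTIFICATE.  `IsOpen K′ ∧ (∀ g k ∈ K′, H(gk) = H(g)) → False`: the continuous torus ray `ρ` of ★ `exists_torusRay_two` has `ρ 0 = 1` and `H(ρ(s)·t) = e^{[E:ℚ]s}H(t)`, so an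
open `K′` contains some `ρ(s)`, `s ≠ 0`, and `H(1·ρ(s)) = H(1)` contradicts `e^{[E:ℚ]s} ≠ 1`.  Hence ★ F3d-β `exists_sum_pureTensor_eq_norm_le` (and its τ-twin ★ p860842, and every C7
head built on them: ★ p860399∕p860626∕p860672∕p860784∕p860699∕p860884) has jointly unsatisfiable structural hypotheses at `U(J₂)`; this file is the non-vacuous replacement.
THE MATHEMATICS ([MoeglinWaldspurger1995, I.2.17, II.1.1]; [GelbartJacquet1979Corvallis, §3]) — as ★ F3d-β_τ, except CONTINUITY OF `φ_d`: with every double coset open, `d = B(𝔸)wK′` is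
CLOPEN (§1); on `d`, for `g₀ ∈ d` pick `s` with `f_d(e^{Ds}H(g₀)) ≠ 0` (possible since `ψ ≢ 0` on `d` forces `f_d ≢ 0` and `f_d(H(βw))φ_d = ψ`); then near `g₀`,
`φ_d(g) = φ_d(ρ(s)g) = ψ(ρ(s)g) ∕ f_d(e^{Ds}H(g))` (`φ_d` is ray-invariant by `hχray`, `H(ρ(s)g) = e^{Ds}H(g)`) — a quotient of continuous functions; off `d`, `φ_d = 0` on the open `dᶜ`.
* §0 `false_of_isOpen_of_borelHeight_invariant`.  §1 `isClosed_doubleCoset_of_forall_isOpen`.  §2 **`exists_pureTensor_on_doubleCoset_open`**.  §3 **`exists_sum_pureTensor_eq_norm_le_open`**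
  (ω-version) and **`exists_sum_pureTensor_eq_norm_le_open_trivial`** (τ = 1: `ψ(gk) = ψ(g)`, `φ ∈ chiSectionSpace χ K′ 1` — drop-in for ★ F3d-β's consumers).
* FED-BY (chair R39): the structural bundle `hdo ∧ hHK′ ∧ hBK` of §2–§3 is WITNESSED at `K′ = K_∞·K_max,f` (CM pair) by the sibling file `K2E1DoubleCosetsOpenArchLevelU2`
  (`maximalLevel_witness_cm`; general feeder `isOpen_doubleCoset_of_archIwasawa` for every `K′ ⊇ ι_∞(K_∞)` with open finite trace).

HONEST LABEL: HC_CM is proved only modulo the 7 printed citations (2 remaining named inputs: hLiu418 = `stmt-HodgeConjecture-24832`, h413 = `stmt-HodgeConjecture-24833`) until rung 0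
closes; this file asserts no named fact and closes no socket.
References: [MoeglinWaldspurger1995] C. Mœglin, J.-L. Waldspurger, *Spectral Decomposition and Eisenstein Series*, I.2.17, II.1.1; [GelbartJacquet1979Corvallis] S. Gelbart, H. Jacquet,
*Forms of GL(2) from the analytic point of view*, §3; [Garrett2018] P. Garrett, *Modern Analysis of Automorphic Forms by Example*, §1.5, §2.2; [Rogawski1990] J. Rogawski, *Automorphic
Representations of Unitary Groups in Three Variables*, §1.10, §2.2.
-/

set_option autoImplicit false
set_option linter.dupNamespace false  -- the mandated namespace repeats the summit's segment (`HodgeConjecture.HodgeConjecture`)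

noncomputable section

open MeasureTheory Set Filter Topology NumberField IsDedekindDomain
open Literature.NumberTheory.Automorphic Literature.NumberTheory.Automorphic.UnitaryGroup Literature.NumberTheory.GaloisRepresentations
open Summit.HodgeConjecture.HodgeConjecture.Cruxes.H413.K2E1CharacterEisensteinU2Defs
open Summit.HodgeConjecture.HodgeConjecture.Cruxes.H413.K2E1ChiSectionSpaceU2Defs
open Summit.HodgeConjecture.HodgeConjecture.Cruxes.H413.K2E1ChiSectionBridgeU2 (borelHeight_borel_mul_eq_ideleNorm_firstEntryUnit_mul)
open Summit.HodgeConjecture.HodgeConjecture.Cruxes.H413.K2E1ChiIsotypicPureTensorDecompositionU2 (ideleNorm_firstEntryUnit_eq_one_of_mul_eq firstEntryUnit_conj firstEntryUnit_inv_mul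
  firstEntryUnit_inv)
open Summit.HodgeConjecture.HodgeConjecture.Cruxes.H413.K2E1PseudoEisensteinChiSectionStabiliserKTypeU2 (kType_inv chi_firstEntryUnit_eq_kType_of_apply_ne_zero chi_mul_kType_eq_of_eq)
open scoped NNReal

namespace Summit.HodgeConjecture.HodgeConjecture.Cruxes.H413.K2E1ChiIsotypicPureTensorDecompositionOpenCosetsU2

variable {F E : Type} [Field F] [NumberField F] [Field E] [NumberField E] [Algebra F E] {c : E ≃ₐ[F] E}

/-! ## §0 The vacuity certificate: `IsOpen K′` and right-`K′`-invariance of the Borel height are contradictory on `U(J₂)(𝔸_F)` -/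

/-- **`IsOpen K′ ∧ (H right-`K′`-invariant) → False`** on `U(J₂)(𝔸_F)`: the continuous torus ray `ρ` (★ `exists_torusRay_two`: `ρ(a+b) = ρ a ρ b`, `H(ρ(s)t) = e^{[E:ℚ]s}H(t)`) enters any open
`K′` for small `s ≠ 0`, where `H(1·ρ(s)) = H(1)` is impossible.  (So ★ F3d-β ∕ the C7 heads with `hK'o + hHK'` on the same adelic `K′` are vacuous; use §3 below.) [cite: Garrett2018, §1.5] -/
theorem false_of_isOpen_of_borelHeight_invariant (hc : c * c = 1) {K' : Subgroup (quasiSplit F E c 2).Adelic} (hK'o : IsOpen (K' : Set (quasiSplit F E c 2).Adelic))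
    (hHK' : ∀ (g k : (quasiSplit F E c 2).Adelic), k ∈ K' → borelHeight (g * k) = borelHeight g) : False := by
  obtain ⟨ρ, hρc, hρadd, -, hρH⟩ := exists_torusRay_two (F := F) (E := E) (c := c) hc
  set ρ' : ℝ → (quasiSplit F E c 2).Adelic := fun s => (((ρ s : torusInBorel F E c 2) : borelAdelic F E c 2) : (quasiSplit F E c 2).Adelic) with hρ'
  have hρ'c : Continuous ρ' := (continuous_subtype_val.comp continuous_subtype_val).comp hρc
  have hρ0 : ρ 0 = 1 := by
    have h := hρadd 0 0
    rw [add_zero] at h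
    exact (mul_eq_left.1 h.symm)
  have h0 : ρ' 0 ∈ (K' : Set (quasiSplit F E c 2).Adelic) := by
    show (((ρ 0 : torusInBorel F E c 2) : borelAdelic F E c 2) : (quasiSplit F E c 2).Adelic) ∈ (K' : Set (quasiSplit F E c 2).Adelic)
    rw [hρ0]; exact K'.one_mem
  obtain ⟨ε, hε, hball⟩ := Metric.isOpen_iff.1 (hK'o.preimage hρ'c) 0 h0
  have hs : ε / 2 ∈ Metric.ball (0 : ℝ) ε := by
    rw [Metric.mem_ball, dist_zero_right, Real.norm_eq_abs, abs_of_pos (half_pos hε)]; exact half_lt_self hε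
  have hmem : ρ' (ε / 2) ∈ K' := hball hs
  have h1 := hHK' 1 (ρ' (ε / 2)) hmem
  rw [one_mul] at h1
  have h2 := hρH (ε / 2) 1
  rw [mul_one] at h2
  have h3 : (borelHeight (ρ' (ε / 2)) : ℝ) = Real.exp (Module.finrank ℚ E * (ε / 2)) * borelHeight (1 : (quasiSplit F E c 2).Adelic) := h2
  rw [h1] at h3
  have hH1 : (0 : ℝ) < borelHeight (1 : (quasiSplit F E c 2).Adelic) := borelHeight_pos _
  have hexp : Real.exp (Module.finrank ℚ E * (ε / 2)) = 1 := by
    have h4 : Real.exp (Module.finrank ℚ E * (ε / 2)) * borelHeight (1 : (quasiSplit F E c 2).Adelic) = 1 * borelHeight (1 : (quasiSplit F E c 2).Adelic) := by rw [one_mul]; exact h3.symm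
    exact mul_right_cancel₀ hH1.ne' h4
  rw [Real.exp_eq_one_iff] at hexp
  have hD : (0 : ℝ) < Module.finrank ℚ E := by exact_mod_cast Module.finrank_pos
  have : (Module.finrank ℚ E : ℝ) * (ε / 2) ≠ 0 := mul_ne_zero hD.ne' (half_pos hε).ne'
  exact this hexp

/-! ## §1 When every double coset is open, each is clopen -/

/-- **Each `(B(𝔸), K′)`-double coset is CLOSED when all of them are open** (its complement is the union of the other, disjoint, open double cosets). [folklore] -/
theorem isClosed_doubleCoset_of_forall_isOpen {K' : Subgroup (quasiSplit F E c 2).Adelic}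
    (hdo : ∀ w : (quasiSplit F E c 2).Adelic, IsOpen (DoubleCoset.doubleCoset w (borelAdelic F E c 2 : Set (quasiSplit F E c 2).Adelic) K')) (w : (quasiSplit F E c 2).Adelic) :
    IsClosed (DoubleCoset.doubleCoset w (borelAdelic F E c 2 : Set (quasiSplit F E c 2).Adelic) K') := by
  rw [← isOpen_compl_iff, isOpen_iff_forall_mem_open]
  intro g hg
  refine ⟨DoubleCoset.doubleCoset g (borelAdelic F E c 2 : Set (quasiSplit F E c 2).Adelic) K', fun x hx hxw => hg ?_, hdo g,
    DoubleCoset.mem_doubleCoset_self (borelAdelic F E c 2) K' g⟩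
  have h1 := DoubleCoset.doubleCoset_eq_of_mem (H := borelAdelic F E c 2) (K := K') hx
  have h2 := DoubleCoset.doubleCoset_eq_of_mem (H := borelAdelic F E c 2) (K := K') hxw
  rw [← h2, h1]
  exact DoubleCoset.mem_doubleCoset_self (borelAdelic F E c 2) K' g


/-! ## §2 One double coset: `ψ|_{B(𝔸) w K′} = f_w(H)·φ_w` -/

/-- **ONE OPEN DOUBLE COSET (ω-twisted, no openness of `K′`)**: on an open `d = B(𝔸) w K′` (all double cosets open) a continuous, right-`(K′, ω)`-equivariant, norm-one-Borel `χ`-isotypic `ψ`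
supported in a height band is `f(H)·φ` with `f ∈ C_c((0,∞))` continuous and `φ ∈ chiSectionSpace χ K′ ω` CONTINUOUS (by ray scaling) and vanishing off `d` (`φ(βwk) = χ(β₀₀)·ω(k)`).
[cite: MoeglinWaldspurger1995, I.2.17, II.1.1] [cite: GelbartJacquet1979Corvallis, §3] -/
theorem exists_pureTensor_on_doubleCoset_open (hc : c * c = 1) {K' : Subgroup (quasiSplit F E c 2).Adelic}
    (hdo : ∀ w' : (quasiSplit F E c 2).Adelic, IsOpen (DoubleCoset.doubleCoset w' (borelAdelic F E c 2 : Set (quasiSplit F E c 2).Adelic) K'))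
    (hHK' : ∀ (g k : (quasiSplit F E c 2).Adelic), k ∈ K' → borelHeight (g * k) = borelHeight g)
    (χ : HeckeCharacter E) (hχray : ∀ r : ℝ≥0ˣ, χ (posRealIdele E r) = 1)
    {ω : ↥K' → ℂ} (hωmul : ∀ k k' : ↥K', ω (k * k') = ω k * ω k') (hω1 : ∀ k : ↥K', ‖ω k‖ = 1)
    {ψ : (quasiSplit F E c 2).Adelic → ℂ} (hψc : Continuous ψ) (hψK : ∀ (g : (quasiSplit F E c 2).Adelic) (k : ↥K'), ψ (g * (k : (quasiSplit F E c 2).Adelic)) = ω k * ψ g)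
    (hψχ : ∀ (b : (quasiSplit F E c 2).Adelic) (hb : b ∈ borelAdelic F E c 2), IdeleClassGroup.ideleNorm E (firstEntryUnit hb) = 1 →
      ∀ g, ψ (b * g) = ((χ (firstEntryUnit hb) : ℂˣ) : ℂ) * ψ g)
    {a b : ℝ≥0} (ha : 0 < a) (hband : ∀ g, ψ g ≠ 0 → a ≤ borelHeight g ∧ borelHeight g ≤ b) (w : (quasiSplit F E c 2).Adelic) :
    ∃ (f : ℝ → ℂ) (φ : (quasiSplit F E c 2).Adelic → ℂ), Continuous f ∧ HasCompactSupport f ∧ tsupport f ⊆ Ioi 0 ∧ φ ∈ chiSectionSpace χ K' ω ∧ Continuous φ ∧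
      (∀ g, g ∉ DoubleCoset.doubleCoset w (borelAdelic F E c 2 : Set (quasiSplit F E c 2).Adelic) K' → φ g = 0) ∧
      ∀ g ∈ DoubleCoset.doubleCoset w (borelAdelic F E c 2 : Set (quasiSplit F E c 2).Adelic) K', ψ g = f (borelHeight g) * φ g := by
  classical
  by_cases hvan : ∀ g ∈ DoubleCoset.doubleCoset w (borelAdelic F E c 2 : Set (quasiSplit F E c 2).Adelic) K', ψ g = 0
  · refine ⟨0, 0, continuous_const, HasCompactSupport.of_support_subset_isCompact isCompact_empty (by simp), by simp [tsupport], Submodule.zero_mem _,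
      continuous_const, fun _ _ => rfl, fun g hg => by simp [hvan g hg]⟩
  simp only [not_forall, exists_prop] at hvan
  obtain ⟨g₀, hg₀, hψg₀⟩ := hvan
  obtain ⟨β₀, hβ₀, k₀, hk₀, hg₀eq⟩ := DoubleCoset.mem_doubleCoset.1 hg₀
  have hne : ψ (β₀ * w) ≠ 0 := by
    rw [hg₀eq, hψK _ ⟨k₀, hk₀⟩] at hψg₀
    exact right_ne_zero_of_mul hψg₀
  -- the diagonal ray
  obtain ⟨ρ, hρc, -, hρd, -⟩ := exists_torusRay_two (F := F) (E := E) (c := c) hc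
  set D : ℝ := (Module.finrank ℚ E : ℝ) with hD
  have hDpos : 0 < D := by rw [hD]; exact_mod_cast Module.finrank_pos
  have hρB : ∀ s, (((ρ s : torusInBorel F E c 2) : borelAdelic F E c 2) : (quasiSplit F E c 2).Adelic) ∈ borelAdelic F E c 2 := fun s => ((ρ s : torusInBorel F E c 2) : borelAdelic F E c 2).2
  have hρfe : ∀ s, firstEntryUnit (hρB s) = posRealIdele E (expUnitNNReal s) := fun s => by rw [firstEntryUnit_eq_diagUnit_zero]; exact hρd s
  have hρN : ∀ s, IdeleClassGroup.ideleNorm E (firstEntryUnit (hρB s)) = ((expUnitNNReal (Module.finrank ℚ E * s) : ℝ≥0ˣ) : ℝ≥0) := fun s => by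
    rw [hρfe, UnitaryGroup.ideleNorm_posRealIdele_expUnitNNReal]
  have hχρ : ∀ s, ((χ (firstEntryUnit (hρB s)) : ℂˣ) : ℂ) = 1 := fun s => by rw [hρfe, hχray, Units.val_one]
  have hHρ : ∀ (s : ℝ) (g : (quasiSplit F E c 2).Adelic), (borelHeight ((((ρ s : torusInBorel F E c 2) : borelAdelic F E c 2) : (quasiSplit F E c 2).Adelic) * g) : ℝ) =
      Real.exp (D * s) * borelHeight g := fun s g => by
    rw [borelHeight_borel_mul_eq_ideleNorm_firstEntryUnit_mul (hρB s), hρN s, NNReal.coe_mul]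
    rfl
  -- the functions
  set f : ℝ → ℂ := fun h => if 0 < h then ψ ((((ρ (Real.log (h / borelHeight w) / D) : torusInBorel F E c 2) : borelAdelic F E c 2) : (quasiSplit F E c 2).Adelic) * w) else 0 with hf
  set φ : (quasiSplit F E c 2).Adelic → ℂ := fun g =>
    if hg : g ∈ DoubleCoset.doubleCoset w (borelAdelic F E c 2 : Set (quasiSplit F E c 2).Adelic) K' then
      ((χ (firstEntryUnit (DoubleCoset.mem_doubleCoset.1 hg).choose_spec.1) : ℂˣ) : ℂ) *
        ω ⟨(DoubleCoset.mem_doubleCoset.1 hg).choose_spec.2.choose, (DoubleCoset.mem_doubleCoset.1 hg).choose_spec.2.choose_spec.1⟩ else 0 with hφ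
  -- evaluation of `φ` on any representation
  have hφev : ∀ (β : (quasiSplit F E c 2).Adelic) (hβ : β ∈ borelAdelic F E c 2) (k : (quasiSplit F E c 2).Adelic) (hk : k ∈ K'),
      φ (β * w * k) = ((χ (firstEntryUnit hβ) : ℂˣ) : ℂ) * ω ⟨k, hk⟩ := fun β hβ k hk => by
    have hg : β * w * k ∈ DoubleCoset.doubleCoset w (borelAdelic F E c 2 : Set (quasiSplit F E c 2).Adelic) K' := DoubleCoset.mem_doubleCoset.2 ⟨β, hβ, k, hk, rfl⟩
    simp only [hφ, dif_pos hg]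
    have hspec := (DoubleCoset.mem_doubleCoset.1 hg).choose_spec
    exact (chi_mul_kType_eq_of_eq hHK' χ hωmul hω1 hψK hψχ hβ₀ hne hβ hspec.1 hk hspec.2.choose_spec.1 hspec.2.choose_spec.2).symm
  have hφK : ∀ (g : (quasiSplit F E c 2).Adelic) (k : ↥K'), φ (g * (k : (quasiSplit F E c 2).Adelic)) = ω k * φ g := fun g k => by
    by_cases hg : g ∈ DoubleCoset.doubleCoset w (borelAdelic F E c 2 : Set (quasiSplit F E c 2).Adelic) K'
    · obtain ⟨β, hβ, k', hk', rfl⟩ := DoubleCoset.mem_doubleCoset.1 hg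
      rw [mul_assoc (β * w), hφev β hβ _ (K'.mul_mem hk' k.2), hφev β hβ _ hk',
        show (⟨k' * (k : (quasiSplit F E c 2).Adelic), K'.mul_mem hk' k.2⟩ : ↥K') = ⟨k', hk'⟩ * k from rfl, hωmul]
      ring
    · have hgk : g * (k : (quasiSplit F E c 2).Adelic) ∉ DoubleCoset.doubleCoset w (borelAdelic F E c 2 : Set (quasiSplit F E c 2).Adelic) K' := fun hmem => hg (by
        obtain ⟨x, hx, y, hy, hxy⟩ := DoubleCoset.mem_doubleCoset.1 hmem
        exact DoubleCoset.mem_doubleCoset.2 ⟨x, hx, y * (k : (quasiSplit F E c 2).Adelic)⁻¹, K'.mul_mem hy (K'.inv_mem k.2), by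
          rw [← mul_assoc, ← hxy, mul_inv_cancel_right]⟩)
      simp only [hφ, dif_neg hg, dif_neg hgk, mul_zero]
  have hφoff : ∀ g, g ∉ DoubleCoset.doubleCoset w (borelAdelic F E c 2 : Set (quasiSplit F E c 2).Adelic) K' → φ g = 0 := fun g hg => by simp only [hφ, dif_neg hg]
  -- the height of `ρ(s_h) w` is `h`
  have hHw : ∀ h : ℝ, 0 < h → (borelHeight ((((ρ (Real.log (h / borelHeight w) / D) : torusInBorel F E c 2) : borelAdelic F E c 2) : (quasiSplit F E c 2).Adelic) * w) : ℝ) = h :=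
    fun h hh => by
    have hw : (0 : ℝ) < borelHeight w := borelHeight_pos w
    rw [hHρ, mul_div_cancel₀ _ hDpos.ne', Real.exp_log (div_pos hh hw), div_mul_cancel₀ _ hw.ne']
  -- `f` vanishes below `a` and above `b`
  have hfzero : ∀ h : ℝ, (h < a ∨ (b : ℝ) < h) → f h = 0 := fun h hh => by
    simp only [hf]
    split_ifs with hpos
    · by_contra hψ
      have hb := hband _ hψ
      have hH := hHw h hpos
      rcases hh with hlt | hgt
      · have h1 : ((a : ℝ≥0) : ℝ) ≤ h := by rw [← hH]; exact_mod_cast hb.1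
        exact absurd hlt (not_lt.2 h1)
      · have h1 : h ≤ ((b : ℝ≥0) : ℝ) := by rw [← hH]; exact_mod_cast hb.2
        exact absurd hgt (not_lt.2 h1)
    · rfl
  have hfc : Continuous f := by
    refine continuous_iff_continuousAt.2 fun h₀ => ?_
    by_cases h₀pos : 0 < h₀
    · have hF : ContinuousAt (fun h : ℝ => ψ ((((ρ (Real.log (h / borelHeight w) / D) : torusInBorel F E c 2) : borelAdelic F E c 2) : (quasiSplit F E c 2).Adelic) * w)) h₀ := by
        have hw : (0 : ℝ) < borelHeight w := borelHeight_pos w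
        have h1 : ContinuousAt (fun h : ℝ => h / (borelHeight w : ℝ)) h₀ := continuousAt_id.div_const _
        have h2 : ContinuousAt Real.log ((fun h : ℝ => h / (borelHeight w : ℝ)) h₀) := Real.continuousAt_log (div_pos h₀pos hw).ne'
        have hlog : ContinuousAt (fun h : ℝ => Real.log (h / borelHeight w) / D) h₀ := by
          have h3 := (ContinuousAt.comp (f := fun h : ℝ => h / (borelHeight w : ℝ)) (g := Real.log) h2 h1).div_const D
          simpa only [Function.comp_def] using h3
        exact (hψc.continuousAt).comp ((((continuous_subtype_val.comp continuous_subtype_val).comp hρc).continuousAt.comp hlog).mul continuousAt_const)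
      refine hF.congr (Filter.eventuallyEq_of_mem (Ioi_mem_nhds h₀pos) fun h hh => ?_)
      simp only [hf, if_pos (show 0 < h from hh)]
    · refine (continuousAt_const (y := (0 : ℂ))).congr (Filter.eventuallyEq_of_mem (Iio_mem_nhds (show h₀ < (a : ℝ) from (not_lt.1 h₀pos).trans_lt (by exact_mod_cast ha))) ?_)
      intro h hh
      exact (hfzero h (Or.inl hh)).symm
  have hfsupp : Function.support f ⊆ Icc (a : ℝ) b := fun h hh => by
    by_contra hI
    rw [mem_Icc, not_and_or, not_le, not_le] at hI
    exact hh (hfzero h hI)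
  have hφV : φ ∈ chiSectionSpace χ K' ω := by
    refine (mem_chiSectionSpace_iff φ).2 ⟨fun b' hb' g => ?_, fun g k => hφK g k⟩
    by_cases hg : g ∈ DoubleCoset.doubleCoset w (borelAdelic F E c 2 : Set (quasiSplit F E c 2).Adelic) K'
    · obtain ⟨β, hβ, k, hk, rfl⟩ := DoubleCoset.mem_doubleCoset.1 hg
      rw [show b' * (β * w * k) = b' * β * w * k by simp only [mul_assoc], hφev _ ((borelAdelic F E c 2).mul_mem hb' hβ) k hk, hφev β hβ k hk,
        firstEntryUnit_mul hb' hβ, map_mul, Units.val_mul, mul_assoc]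
    · have hbg : b' * g ∉ DoubleCoset.doubleCoset w (borelAdelic F E c 2 : Set (quasiSplit F E c 2).Adelic) K' := fun hmem => hg (by
        obtain ⟨x, hx, y, hy, hxy⟩ := DoubleCoset.mem_doubleCoset.1 hmem
        exact DoubleCoset.mem_doubleCoset.2 ⟨b'⁻¹ * x, (borelAdelic F E c 2).mul_mem ((borelAdelic F E c 2).inv_mem hb') hx, y, hy, by
          rw [mul_assoc b'⁻¹, mul_assoc b'⁻¹, ← hxy, inv_mul_cancel_left]⟩)
      rw [hφoff _ hg, hφoff _ hbg, mul_zero]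

  have hident : ∀ g ∈ DoubleCoset.doubleCoset w (borelAdelic F E c 2 : Set (quasiSplit F E c 2).Adelic) K', ψ g = f (borelHeight g) * φ g := by
    intro g hg
    obtain ⟨β, hβ, k, hk, rfl⟩ := DoubleCoset.mem_doubleCoset.1 hg
    rw [hφev β hβ k hk, hψK _ ⟨k, hk⟩, hHK' _ _ hk]
    -- `β = β₁ ρ(s)`, `e^{Ds} = ‖β₀₀‖`
    set nβ : ℝ≥0 := IdeleClassGroup.ideleNorm E (firstEntryUnit hβ) with hnβ
    have hnβpos : (0 : ℝ) < nβ := by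
      have h := borelHeight_borel_mul_eq_ideleNorm_firstEntryUnit_mul hβ w
      have h1 : nβ * borelHeight w ≠ 0 := by rw [hnβ, ← h]; exact (borelHeight_pos _).ne'
      have h2 : nβ ≠ 0 := left_ne_zero_of_mul h1
      exact_mod_cast pos_iff_ne_zero.2 h2
    set s : ℝ := Real.log nβ / D with hs
    have hexp : Real.exp (D * s) = nβ := by rw [hs, mul_div_cancel₀ _ hDpos.ne', Real.exp_log hnβpos]
    have hexpU : ((expUnitNNReal (Module.finrank ℚ E * s) : ℝ≥0ˣ) : ℝ≥0) = nβ := NNReal.eq hexp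
    -- `β₁ := β ρ(s)⁻¹` is norm-one
    have hβ₁ : β * ((((ρ s : torusInBorel F E c 2) : borelAdelic F E c 2) : (quasiSplit F E c 2).Adelic))⁻¹ ∈ borelAdelic F E c 2 :=
      (borelAdelic F E c 2).mul_mem hβ ((borelAdelic F E c 2).inv_mem (hρB s))
    have hfe₁ : firstEntryUnit hβ₁ = firstEntryUnit hβ * (firstEntryUnit (hρB s))⁻¹ := by
      rw [show firstEntryUnit hβ₁ = firstEntryUnit ((borelAdelic F E c 2).mul_mem hβ ((borelAdelic F E c 2).inv_mem (hρB s))) from rfl,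
        firstEntryUnit_mul hβ ((borelAdelic F E c 2).inv_mem (hρB s)), firstEntryUnit_inv (hρB s)]
    have hN₁ : IdeleClassGroup.ideleNorm E (firstEntryUnit hβ₁) = 1 := by
      rw [hfe₁, map_mul, map_inv, hρN s, hexpU, ← hnβ, mul_inv_cancel₀ (ne_of_gt (by exact_mod_cast hnβpos))]
    have hχ₁ : ((χ (firstEntryUnit hβ₁) : ℂˣ) : ℂ) = ((χ (firstEntryUnit hβ) : ℂˣ) : ℂ) := by
      rw [hfe₁, map_mul, map_inv, Units.val_mul, Units.val_inv_eq_inv_val, hχρ s, inv_one, mul_one]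
    -- `ψ(β w) = χ(β₀₀) ψ(ρ(s) w)`
    have hψβ : ψ (β * w) = ((χ (firstEntryUnit hβ) : ℂˣ) : ℂ) * ψ ((((ρ s : torusInBorel F E c 2) : borelAdelic F E c 2) : (quasiSplit F E c 2).Adelic) * w) := by
      have h1 := hψχ _ hβ₁ hN₁ ((((ρ s : torusInBorel F E c 2) : borelAdelic F E c 2) : (quasiSplit F E c 2).Adelic) * w)
      rw [hχ₁, ← mul_assoc, inv_mul_cancel_right] at h1
      exact h1
    -- `f(H(βw)) = ψ(ρ(s) w)`
    have hHβw : ((borelHeight (β * w) : ℝ≥0) : ℝ) = nβ * borelHeight w := by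
      rw [borelHeight_borel_mul_eq_ideleNorm_firstEntryUnit_mul hβ w, NNReal.coe_mul]
    have hpos : (0 : ℝ) < borelHeight (β * w) := borelHeight_pos _
    have hfval : f (borelHeight (β * w)) = ψ ((((ρ s : torusInBorel F E c 2) : borelAdelic F E c 2) : (quasiSplit F E c 2).Adelic) * w) := by
      simp only [hf, if_pos hpos]
      have hw : (borelHeight w : ℝ) ≠ 0 := NNReal.coe_ne_zero.2 (borelHeight_pos w).ne'
      rw [hHβw, mul_div_cancel_right₀ _ hw]
    rw [hfval, hψβ]
    ring
  -- ray invariance of `φ` and the height scaling along the ray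
  have hφρ : ∀ (s : ℝ) (g : (quasiSplit F E c 2).Adelic), φ ((((ρ s : torusInBorel F E c 2) : borelAdelic F E c 2) : (quasiSplit F E c 2).Adelic) * g) = φ g := fun s g => by
    by_cases hg : g ∈ DoubleCoset.doubleCoset w (borelAdelic F E c 2 : Set (quasiSplit F E c 2).Adelic) K'
    · obtain ⟨β, hβ, k, hk, rfl⟩ := DoubleCoset.mem_doubleCoset.1 hg
      rw [show (((ρ s : torusInBorel F E c 2) : borelAdelic F E c 2) : (quasiSplit F E c 2).Adelic) * (β * w * k) =
          (((ρ s : torusInBorel F E c 2) : borelAdelic F E c 2) : (quasiSplit F E c 2).Adelic) * β * w * k by simp only [mul_assoc],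
        hφev _ ((borelAdelic F E c 2).mul_mem (hρB s) hβ) k hk, hφev β hβ k hk, firstEntryUnit_mul (hρB s) hβ, map_mul, Units.val_mul, hχρ s, one_mul]
    · have hg' : (((ρ s : torusInBorel F E c 2) : borelAdelic F E c 2) : (quasiSplit F E c 2).Adelic) * g ∉ DoubleCoset.doubleCoset w (borelAdelic F E c 2 : Set (quasiSplit F E c 2).Adelic) K' := fun hmem => hg (by
        obtain ⟨x, hx, y, hy, hxy⟩ := DoubleCoset.mem_doubleCoset.1 hmem
        exact DoubleCoset.mem_doubleCoset.2 ⟨((((ρ s : torusInBorel F E c 2) : borelAdelic F E c 2) : (quasiSplit F E c 2).Adelic))⁻¹ * x,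
          (borelAdelic F E c 2).mul_mem ((borelAdelic F E c 2).inv_mem (hρB s)) hx, y, hy, by rw [mul_assoc _ x, mul_assoc _ (x * w), ← hxy, inv_mul_cancel_left]⟩)
      rw [hφoff _ hg, hφoff _ hg']
  -- CONTINUITY OF `φ` BY RAY SCALING (no Iwasawa coordinates): `d` is clopen; on `d`, `φ = ψ(ρ(s)·) / f(e^{Ds}H)` near each point
  have hdc : IsClosed (DoubleCoset.doubleCoset w (borelAdelic F E c 2 : Set (quasiSplit F E c 2).Adelic) K') := isClosed_doubleCoset_of_forall_isOpen hdo w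
  have hφc : Continuous φ := by
    refine continuous_iff_continuousAt.2 fun g₀ => ?_
    by_cases hg₀ : g₀ ∈ DoubleCoset.doubleCoset w (borelAdelic F E c 2 : Set (quasiSplit F E c 2).Adelic) K'
    · -- a height where `f ≠ 0`: `h₁ = H(β₀ w)` (`f(h₁)·φ(β₀ w) = ψ(β₀ w) ≠ 0`)
      have hβ₀w : β₀ * w ∈ DoubleCoset.doubleCoset w (borelAdelic F E c 2 : Set (quasiSplit F E c 2).Adelic) K' :=
        DoubleCoset.mem_doubleCoset.2 ⟨β₀, hβ₀, 1, K'.one_mem, (mul_one _).symm⟩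
      have hf₁ : f (borelHeight (β₀ * w)) ≠ 0 := fun h0 => hne (by rw [hident _ hβ₀w, h0, zero_mul])
      have hH₀ : (0 : ℝ) < borelHeight g₀ := borelHeight_pos _
      have hH₁ : (0 : ℝ) < borelHeight (β₀ * w) := borelHeight_pos _
      set s : ℝ := Real.log ((borelHeight (β₀ * w) : ℝ) / borelHeight g₀) / D with hs
      have hscale : Real.exp (D * s) * (borelHeight g₀ : ℝ) = borelHeight (β₀ * w) := by
        rw [hs, mul_div_cancel₀ _ hDpos.ne', Real.exp_log (div_pos hH₁ hH₀), div_mul_cancel₀ _ hH₀.ne']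
      -- the open neighbourhood `U = d ∩ {f(e^{Ds}H) ≠ 0}`
      have hFc : Continuous fun g : (quasiSplit F E c 2).Adelic => f (Real.exp (D * s) * (borelHeight g : ℝ)) :=
        hfc.comp (continuous_const.mul (NNReal.continuous_coe.comp continuous_borelHeight))
      have hUo : IsOpen (DoubleCoset.doubleCoset w (borelAdelic F E c 2 : Set (quasiSplit F E c 2).Adelic) K' ∩ {g | f (Real.exp (D * s) * (borelHeight g : ℝ)) ≠ 0}) :=
        (hdo w).inter (isOpen_ne_fun hFc continuous_const)
      have hg₀U : g₀ ∈ DoubleCoset.doubleCoset w (borelAdelic F E c 2 : Set (quasiSplit F E c 2).Adelic) K' ∩ {g | f (Real.exp (D * s) * (borelHeight g : ℝ)) ≠ 0} :=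
        ⟨hg₀, by rw [Set.mem_setOf_eq, hscale]; exact hf₁⟩
      -- on `U`: `φ g = ψ(ρ(s) g) / f(e^{Ds} H g)`
      have hquot : ContinuousAt (fun g : (quasiSplit F E c 2).Adelic => ψ ((((ρ s : torusInBorel F E c 2) : borelAdelic F E c 2) : (quasiSplit F E c 2).Adelic) * g) / f (Real.exp (D * s) * (borelHeight g : ℝ))) g₀ :=
        ((hψc.comp (continuous_const.mul continuous_id)).continuousAt).div hFc.continuousAt (by rw [hscale]; exact hf₁)
      refine hquot.congr (Filter.eventuallyEq_of_mem (hUo.mem_nhds hg₀U) fun g hg => ?_)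
      obtain ⟨hgd, hgf⟩ := hg
      have hρgd : (((ρ s : torusInBorel F E c 2) : borelAdelic F E c 2) : (quasiSplit F E c 2).Adelic) * g ∈ DoubleCoset.doubleCoset w (borelAdelic F E c 2 : Set (quasiSplit F E c 2).Adelic) K' := by
        obtain ⟨β, hβ, k, hk, rfl⟩ := DoubleCoset.mem_doubleCoset.1 hgd
        exact DoubleCoset.mem_doubleCoset.2 ⟨_ , (borelAdelic F E c 2).mul_mem (hρB s) hβ, k, hk, by simp only [mul_assoc]⟩
      have h1 := hident _ hρgd
      rw [hHρ s g, hφρ s g] at h1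
      rw [Set.mem_setOf_eq] at hgf
      show ψ (_ * g) / f _ = φ g
      rw [h1, mul_div_cancel_left₀ (φ g) hgf]
    · exact (continuousAt_const (y := (0 : ℂ))).congr (Filter.eventuallyEq_of_mem (hdc.isOpen_compl.mem_nhds hg₀) fun g hg => (hφoff g hg).symm)
  exact ⟨f, φ, hfc, HasCompactSupport.of_support_subset_isCompact isCompact_Icc hfsupp,
    (closure_minimal hfsupp isClosed_Icc).trans fun h hh => lt_of_lt_of_le (by exact_mod_cast ha) hh.1, hφV, hφc, hφoff, hident⟩

/-! ## §3 The decomposition -/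

/-- **THE PURE-TENSOR DECOMPOSITION (ω-twisted, OPEN DOUBLE COSETS), WITH TERMWISE DOMINATION** — the NON-VACUOUS replacement of ★ F3d-β ∕ ★ F3d-β_τ: with finitely many
`(B(𝔸), K′)`-double cosets (`hBK`) all OPEN (`hdo`), a continuous right-`(K′, ω)`-equivariant norm-one-Borel `χ`-isotypic `ψ` supported in a height band is a FINITE SUM
`ψ(g) = Σ_i f_i(H(g))·φ_i(g)` with `f_i ∈ C_c((0,∞))` continuous, `φ_i ∈ chiSectionSpace χ K′ ω` CONTINUOUS, and `|f_i(H(g)) φ_i(g)| ≤ |ψ(g)|` termwise.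
[cite: MoeglinWaldspurger1995, I.2.17, II.1.1] [cite: GelbartJacquet1979Corvallis, §3] -/
theorem exists_sum_pureTensor_eq_norm_le_open (hc : c * c = 1) {K' : Subgroup (quasiSplit F E c 2).Adelic}
    (hdo : ∀ w' : (quasiSplit F E c 2).Adelic, IsOpen (DoubleCoset.doubleCoset w' (borelAdelic F E c 2 : Set (quasiSplit F E c 2).Adelic) K'))
    (hHK' : ∀ (g k : (quasiSplit F E c 2).Adelic), k ∈ K' → borelHeight (g * k) = borelHeight g)
    (hBK : ∃ W : Finset (quasiSplit F E c 2).Adelic, ∀ g : (quasiSplit F E c 2).Adelic, ∃ β ∈ borelAdelic F E c 2, ∃ w ∈ W, ∃ k ∈ K', g = β * w * k)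
    (χ : HeckeCharacter E) (hχray : ∀ r : ℝ≥0ˣ, χ (posRealIdele E r) = 1)
    {ω : ↥K' → ℂ} (hωmul : ∀ k k' : ↥K', ω (k * k') = ω k * ω k') (hω1 : ∀ k : ↥K', ‖ω k‖ = 1)
    {ψ : (quasiSplit F E c 2).Adelic → ℂ} (hψc : Continuous ψ) (hψK : ∀ (g : (quasiSplit F E c 2).Adelic) (k : ↥K'), ψ (g * (k : (quasiSplit F E c 2).Adelic)) = ω k * ψ g)
    (hψχ : ∀ (b : (quasiSplit F E c 2).Adelic) (hb : b ∈ borelAdelic F E c 2), IdeleClassGroup.ideleNorm E (firstEntryUnit hb) = 1 →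
      ∀ g, ψ (b * g) = ((χ (firstEntryUnit hb) : ℂˣ) : ℂ) * ψ g)
    {a b : ℝ≥0} (ha : 0 < a) (hband : ∀ g, ψ g ≠ 0 → a ≤ borelHeight g ∧ borelHeight g ≤ b) :
    ∃ (ι : Type) (_ : Fintype ι) (f : ι → ℝ → ℂ) (φ : ι → (quasiSplit F E c 2).Adelic → ℂ),
      (∀ i, Continuous (f i) ∧ HasCompactSupport (f i) ∧ tsupport (f i) ⊆ Ioi 0 ∧ φ i ∈ chiSectionSpace χ K' ω ∧ Continuous (φ i) ∧
        ∀ g, ‖f i (borelHeight g) * φ i g‖ ≤ ‖ψ g‖) ∧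
      ∀ g, ψ g = ∑ i, f i (borelHeight g) * φ i g := by
  classical
  obtain ⟨W, hW⟩ := hBK
  set Q : Finset (DoubleCoset.Quotient (borelAdelic F E c 2 : Set (quasiSplit F E c 2).Adelic) (K' : Set (quasiSplit F E c 2).Adelic)) :=
    W.image (fun w => DoubleCoset.mk (borelAdelic F E c 2) K' w) with hQ
  have hD := fun q : ↥Q => exists_pureTensor_on_doubleCoset_open hc hdo hHK' χ hχray hωmul hω1 hψc hψK hψχ ha hband (q.1.out : (quasiSplit F E c 2).Adelic)
  choose f φ hf hfs hf0 hφV hφc hφoff hψeq using hD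
  refine ⟨↥Q, inferInstance, f, φ, fun q => ⟨hf q, hfs q, hf0 q, hφV q, hφc q, fun g => ?_⟩, fun g => ?_⟩
  · by_cases hg : g ∈ DoubleCoset.doubleCoset (q.1.out : (quasiSplit F E c 2).Adelic) (borelAdelic F E c 2 : Set (quasiSplit F E c 2).Adelic) K'
    · rw [← hψeq q g hg]
    · rw [hφoff q g hg, mul_zero, norm_zero]; exact norm_nonneg _
  -- the class of `g`
  obtain ⟨β, hβ, w, hw, k, hk, hgeq⟩ := hW g
  have hgq : DoubleCoset.mk (borelAdelic F E c 2) K' g ∈ Q := by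
    rw [hQ, Finset.mem_image]
    exact ⟨w, hw, (DoubleCoset.eq _ _ w g).2 ⟨β, hβ, k, hk, hgeq⟩⟩
  set q₀ : ↥Q := ⟨DoubleCoset.mk (borelAdelic F E c 2) K' g, hgq⟩ with hq₀
  have hmem : ∀ q : ↥Q, g ∈ DoubleCoset.doubleCoset (q.1.out : (quasiSplit F E c 2).Adelic) (borelAdelic F E c 2 : Set (quasiSplit F E c 2).Adelic) K' ↔ q = q₀ := fun q => by
    rw [DoubleCoset.mem_doubleCoset]
    constructor
    · rintro ⟨x, hx, y, hy, hxy⟩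
      apply Subtype.ext
      rw [hq₀]
      show q.1 = DoubleCoset.mk (borelAdelic F E c 2) K' g
      rw [← DoubleCoset.out_eq' _ _ q.1]
      exact (DoubleCoset.eq _ _ _ g).2 ⟨x, hx, y, hy, hxy⟩
    · rintro rfl
      have h := (DoubleCoset.eq (borelAdelic F E c 2) K' (q₀.1.out) g).1 (by rw [DoubleCoset.out_eq'])
      obtain ⟨x, hx, y, hy, hxy⟩ := h
      exact ⟨x, hx, y, hy, hxy⟩
  rw [Finset.sum_eq_single q₀ (fun q _ hq => by rw [hφoff q g (fun hm => hq ((hmem q).1 hm)), mul_zero]) (fun hq => absurd (Finset.mem_univ q₀) hq)]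
  exact hψeq q₀ g ((hmem q₀).2 rfl)

/-- **THE τ = 1 DROP-IN FOR ★ F3d-β's CONSUMERS** (`ψ(g k) = ψ(g)`, `φ_i ∈ chiSectionSpace χ K′ 1`): `exists_sum_pureTensor_eq_norm_le_open` at `ω ≡ 1`.
[cite: MoeglinWaldspurger1995, I.2.17, II.1.1] -/
theorem exists_sum_pureTensor_eq_norm_le_open_trivial (hc : c * c = 1) {K' : Subgroup (quasiSplit F E c 2).Adelic}
    (hdo : ∀ w' : (quasiSplit F E c 2).Adelic, IsOpen (DoubleCoset.doubleCoset w' (borelAdelic F E c 2 : Set (quasiSplit F E c 2).Adelic) K'))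
    (hHK' : ∀ (g k : (quasiSplit F E c 2).Adelic), k ∈ K' → borelHeight (g * k) = borelHeight g)
    (hBK : ∃ W : Finset (quasiSplit F E c 2).Adelic, ∀ g : (quasiSplit F E c 2).Adelic, ∃ β ∈ borelAdelic F E c 2, ∃ w ∈ W, ∃ k ∈ K', g = β * w * k)
    (χ : HeckeCharacter E) (hχray : ∀ r : ℝ≥0ˣ, χ (posRealIdele E r) = 1)
    {ψ : (quasiSplit F E c 2).Adelic → ℂ} (hψc : Continuous ψ) (hψK : ∀ (g k : (quasiSplit F E c 2).Adelic), k ∈ K' → ψ (g * k) = ψ g)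
    (hψχ : ∀ (b : (quasiSplit F E c 2).Adelic) (hb : b ∈ borelAdelic F E c 2), IdeleClassGroup.ideleNorm E (firstEntryUnit hb) = 1 →
      ∀ g, ψ (b * g) = ((χ (firstEntryUnit hb) : ℂˣ) : ℂ) * ψ g)
    {a b : ℝ≥0} (ha : 0 < a) (hband : ∀ g, ψ g ≠ 0 → a ≤ borelHeight g ∧ borelHeight g ≤ b) :
    ∃ (ι : Type) (_ : Fintype ι) (f : ι → ℝ → ℂ) (φ : ι → (quasiSplit F E c 2).Adelic → ℂ),
      (∀ i, Continuous (f i) ∧ HasCompactSupport (f i) ∧ tsupport (f i) ⊆ Ioi 0 ∧ φ i ∈ chiSectionSpace χ K' 1 ∧ Continuous (φ i) ∧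
        ∀ g, ‖f i (borelHeight g) * φ i g‖ ≤ ‖ψ g‖) ∧
      ∀ g, ψ g = ∑ i, f i (borelHeight g) * φ i g :=
  exists_sum_pureTensor_eq_norm_le_open hc hdo hHK' hBK χ hχray (ω := (1 : ↥K' → ℂ)) (fun _ _ => by simp) (fun _ => by simp) hψc
    (fun g k => by rw [hψK g k k.2, Pi.one_apply, one_mul]) hψχ ha hband

end Summit.HodgeConjecture.HodgeConjecture.Cruxes.H413.K2E1ChiIsotypicPureTensorDecompositionOpenCosetsU2

end
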